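import Literature.AlgebraicGeometry.Motives.AbelianVarietyTranslation
import Literature.AlgebraicGeometry.Motives.AbelianVarietyTheoremOfCube
import Literature.AlgebraicGeometry.Motives.CartierDivisorClassMap
import Literature.AlgebraicGeometry.Motives.SeesawTheorem
import HarnessLib

/-!
# The biadditive pairing of the cubical structure; rational points in the two forms

Bookkeeping for the theorem of the cube on an abelian variety `X` over a field `K`, with values in an
additive class map `cl : Div(T) → Q` (`CartierDivisor.exists_classMap`: additive, `cl D = cl E ↔ D ∼ E`)
on an integral `K`-scheme `T`:

* `lam L cl x = cl (x^* L)` for a `T`-valued point `x : T → X`, and Mumford's pairing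
  `Lam L cl x y = λ(x y) - λ(x) - λ(y)` (the class of `Λ(L) = m^*L - p₁^*L - p₂^*L` along `(x, y)`);
* `Lam_mul_left` / `Lam_mul_right` — **the cubical structure (`AbelianVariety.cubicalStructure_linEquiv`,
  Görtz–Wedhorn II, Prop. 27.167, i.e. the theorem of the cube) says exactly that `Λ` is biadditive**:
  `Λ(x y, z) = Λ(x, z) + Λ(y, z)`; hence `Λ(x, yⁿ) = n • Λ(x, y)` (`Lam_pow_right/left`), `Λ(1, y) = 0`,
  `λ(1) = 0`, `λ(const) = 0`;
* `cl_classPullback_translation_sub` — **`cl (g^* t_P^* L) - cl (g^* L) = Λ(P_T, g)`** with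
  `P_T = (T → Spec K →P X)`: the class of `t_P^* L - L` along `g` is the pairing with the constant
  point (`comp_translation_eq_mul`: on `T`-points `t_P` is multiplication by `P_T`, Görtz–Wedhorn II,
  Def. 27.1);
* rational points: `unitPoint` (a point `Spec K → X` over `K` as a morphism from the monoidal unit),
  `toUnit_comp_unitPoint`, `one_left_closedPoint`, `eq_of_left_closedPoint_eq` (**rational points with
  the same underlying point are equal**), and `isIso_fst_residuePt` (**the fibre `R × Spec κ(t₀) → R`
  over a rational point `t₀` is an isomorphism**, `κ(t₀) = K`; cf. `fromSpecResidueField_eq_comp_section`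
  of `Motives/SeesawTheorem`).

These serve Poincaré's reducibility theorem (`Motives/AbelianVarietyPoincareOrthogonal`,
`Motives/AbelianVarietyPoincareReducibility`). No named facts; the cubical structure enters as a
hypothesis `hcube : X.cubicalStructure_linEquiv`.

Mathlib searched (pin): `MonObj.comp_mul`, `MonObj.comp_one`, `Hom.mul_def`,
`whiskerLeft_toUnit_comp_rightUnitor_hom`, `isIso_of_reflects_iso`, `Scheme.SpecToEquivOfField`,
`Scheme.fromSpecResidueField_apply` (used); no `Pic`, no biextensions in Mathlib.

## References

* U. Görtz, T. Wedhorn, *Algebraic Geometry II*, Springer Spektrum (2023): Prop. 27.167 and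
  (27.30.1) (pp. 877–878), Def. 27.1 (p. 799). [GortzWedhorn2023]
* D. Mumford, *Abelian Varieties*, TIFR Studies in Mathematics 5, OUP (1970): §6, theorem of the
  cube and Cor. 2–4 (pp. 57–59); §8 (the pairing `Λ(L)`). [MumfordAV1970]
-/

universe u v

open CategoryTheory CategoryTheory.Limits AlgebraicGeometry MonoidalCategory CartesianMonoidalCategory
open TopologicalSpace Topology

noncomputable section

namespace Literature.AlgebraicGeometry.Motives

open scoped MonObj

namespace AbelianVariety

section Bilinear

variable {K : Type u} [Field K] {X : AbelianVariety K} (L : CartierDivisor X.X.left)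
  {T : SchemeOver K} [IsIntegral T.left]
  {Q : Type v} [AddCommGroup Q] (cl : CartierDivisor T.left → Q)

/-- `λ(x)`: the class of `x^* L` on `T`, for a `T`-valued point `x : T → X`. [folklore] -/
def lam (x : T ⟶ X.X) : Q := cl (L.classPullback x.left)

/-- `Λ(x, y) = λ(x y) - λ(x) - λ(y)`: the class of Mumford's `Λ(L)` along `(x, y) : T → X × X`.
[folklore] -/
def Lam (x y : T ⟶ X.X) : Q := lam L cl (x * y) - lam L cl x - lam L cl y

variable {L cl}
variable (hadd : ∀ D E : CartierDivisor T.left, cl (D + E) = cl D + cl E)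
  (heq : ∀ D E : CartierDivisor T.left, D.LinEquiv E ↔ cl D = cl E)

/-- `Λ` is symmetric (`A` is commutative). [folklore] -/
theorem Lam_comm (x y : T ⟶ X.X) : Lam L cl x y = Lam L cl y x := by
  unfold Lam; rw [mul_comm]; abel

include heq in
/-- `λ` of a constant `T`-point vanishes: the class pullback along a constant map is trivial.
[folklore] -/
theorem lam_eq_zero_of_const (hadd : ∀ D E : CartierDivisor T.left, cl (D + E) = cl D + cl E)
    {x : T ⟶ X.X} (hx : ∀ a a' : T.left, x.left a = x.left a') : lam L cl x = 0 := by
  unfold lam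
  rw [← CartierDivisor.classMap_zero hadd heq]
  exact (heq _ _).1 (CartierDivisor.classPullback_linEquiv_zero_of_const _ hx L)

include heq in
/-- `λ(1) = 0`. [folklore] -/
theorem lam_one (hadd : ∀ D E : CartierDivisor T.left, cl (D + E) = cl D + cl E) :
    lam L cl (1 : T ⟶ X.X) = 0 :=
  lam_eq_zero_of_const heq hadd (fun a a' => by
    rw [one_left, Scheme.Hom.comp_apply, Scheme.Hom.comp_apply, Subsingleton.elim (T.hom a) (T.hom a')])

include heq in
/-- `λ(T → Spec K →P X) = 0` for a rational point `P`. [folklore] -/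
theorem lam_toSpecOver_comp (hadd : ∀ D E : CartierDivisor T.left, cl (D + E) = cl D + cl E)
    (P : X.Points K) : lam L cl (toSpecOver T ≫ P) = 0 :=
  lam_eq_zero_of_const heq hadd (fun a a' => by
    rw [Over.comp_left, Scheme.Hom.comp_apply, Scheme.Hom.comp_apply]
    congr 1
    exact Subsingleton.elim (α := ↥(Spec (CommRingCat.of K))) _ _)

include heq in
/-- `Λ(1, y) = 0`. [folklore] -/
theorem Lam_one_left (hadd : ∀ D E : CartierDivisor T.left, cl (D + E) = cl D + cl E)
    (y : T ⟶ X.X) : Lam L cl 1 y = 0 := by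
  unfold Lam; rw [one_mul, lam_one heq hadd]; abel

include hadd heq in
/-- **The cubical structure is the biadditivity of `Λ`**: `Λ(x y, z) = Λ(x, z) + Λ(y, z)`
(Görtz–Wedhorn II, Prop. 27.167: the eight-term cube relation, rearranged). [folklore] -/
theorem Lam_mul_left (hcube : X.cubicalStructure_linEquiv) (x y z : T ⟶ X.X) :
    Lam L cl (x * y) z = Lam L cl x z + Lam L cl y z := by
  have h := (heq _ _).1 (hcube T x y z L)
  simp only [hadd] at h
  have h1 : cl (L.classPullback (1 : T ⟶ X.X).left) = 0 := lam_one heq hadd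
  rw [h1, add_zero] at h
  change lam L cl (x * y * z) + lam L cl x + lam L cl y + lam L cl z =
    lam L cl (x * y) + lam L cl (x * z) + lam L cl (y * z) at h
  have key : lam L cl (x * y * z) = lam L cl (x * y) + lam L cl (x * z) + lam L cl (y * z) -
      lam L cl x - lam L cl y - lam L cl z := by
    rw [← h]; abel
  unfold Lam
  rw [key]
  abel

include hadd heq in
/-- `Λ(x, y z) = Λ(x, y) + Λ(x, z)`. [folklore] -/
theorem Lam_mul_right (hcube : X.cubicalStructure_linEquiv) (x y z : T ⟶ X.X) :
    Lam L cl x (y * z) = Lam L cl x y + Lam L cl x z := by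
  rw [Lam_comm, Lam_mul_left hadd heq hcube, Lam_comm y, Lam_comm z]

include hadd heq in
/-- `Λ(x, y ^ n) = n • Λ(x, y)`. [folklore] -/
theorem Lam_pow_right (hcube : X.cubicalStructure_linEquiv) (x y : T ⟶ X.X) (n : ℕ) :
    Lam L cl x (y ^ n) = n • Lam L cl x y := by
  induction n with
  | zero => rw [pow_zero, Lam_comm, Lam_one_left heq hadd, zero_smul]
  | succ n ih => rw [pow_succ, Lam_mul_right hadd heq hcube, ih, succ_nsmul]

include hadd heq in
/-- `Λ(x ^ n, y) = n • Λ(x, y)`. [folklore] -/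
theorem Lam_pow_left (hcube : X.cubicalStructure_linEquiv) (x y : T ⟶ X.X) (n : ℕ) :
    Lam L cl (x ^ n) y = n • Lam L cl x y := by
  rw [Lam_comm, Lam_pow_right hadd heq hcube, Lam_comm]

omit [AddCommGroup Q] in
/-- Functoriality of `λ` in `T`: for `φ : T' → T`, the class of `(φ ≫ x)^* L` is that of
`φ^*(x^* L)`. [folklore] -/
theorem lam_comp {T' : SchemeOver K} [IsIntegral T'.left] {Q' : Type v} [AddCommGroup Q']
    {cl' : CartierDivisor T'.left → Q'}
    (heq' : ∀ D E : CartierDivisor T'.left, D.LinEquiv E ↔ cl' D = cl' E)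
    (φ : T' ⟶ T) (x : T ⟶ X.X) :
    lam L cl' (φ ≫ x) = cl' ((L.classPullback x.left).classPullback φ.left) := by
  unfold lam
  rw [Over.comp_left]
  exact (heq' _ _).1 (L.classPullback_comp_linEquiv x.left φ.left)

omit [IsIntegral T.left] in
/-- On `T`-points the translation `t_P` is multiplication by the constant point:
`g ≫ t_P = (T → Spec K →P X) · g`. [folklore] -/
theorem comp_translation_eq_mul (g : T ⟶ X.X) (P : X.Points K) :
    g ≫ X.translation P = (toSpecOver T ≫ P) * g := by
  unfold translation
  rw [MonObj.comp_mul, Category.comp_id, ← Category.assoc]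
  congr 2
  ext1
  rw [Over.comp_left, toSpecOver_left, toSpecOver_left]
  exact Over.w g

include hadd heq in
/-- **The class of `g^*(t_P^* L) - g^* L` is `Λ(P_T, g)`**, `P_T = (T → Spec K →P X)` the constant
point. [folklore] -/
theorem cl_classPullback_translation_sub (g : T ⟶ X.X) (P : X.Points K) :
    cl ((L.classPullback (X.translation P).left).classPullback g.left) - cl (L.classPullback g.left) =
      Lam L cl (toSpecOver T ≫ P) g := by
  unfold Lam
  rw [lam_toSpecOver_comp heq hadd, sub_zero, ← comp_translation_eq_mul]
  unfold lam
  rw [Over.comp_left, (heq _ _).1 (L.classPullback_comp_linEquiv _ _)]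


end Bilinear

section Points

variable {K : Type u} [Field K] (X : AbelianVariety K)

/-- A rational point `P : Spec K → X` over `K` in the form `𝟙 → X` (source the monoidal unit).
[folklore] -/
def unitPoint (P : X.Points K) : 𝟙_ (SchemeOver K) ⟶ X.X :=
  Over.homMk P.left (by
    rw [Over.tensorUnit_hom]
    have h : P.left ≫ X.X.hom = Spec.map (CommRingCat.ofHom (algebraMap K K)) := Over.w P
    rw [Algebra.algebraMap_self, CommRingCat.ofHom_id, Spec.map_id] at h
    exact h)

/-- The underlying morphism of `unitPoint P` is that of `P`. [folklore] -/
@[simp] theorem unitPoint_left (P : X.Points K) : (X.unitPoint P).left = P.left := rfl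

/-- `toUnit T ≫ unitPoint P = toSpecOver T ≫ P` (the constant `T`-point at `P`). [folklore] -/
theorem toUnit_comp_unitPoint {T : SchemeOver K} (P : X.Points K) :
    CartesianMonoidalCategory.toUnit T ≫ X.unitPoint P = toSpecOver T ≫ P := by
  ext1
  rw [Over.comp_left, Over.comp_left, Over.toUnit_left, toSpecOver_left]
  rfl

/-- The underlying point of `1 : Spec K → X` is the origin. [folklore] -/
theorem one_left_closedPoint : (1 : X.Points K).left (IsLocalRing.closedPoint K) = origin X := by
  rw [one_left]
  change (unitPt X) ((specOver K K).hom (IsLocalRing.closedPoint K)) = origin X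
  rw [eq_specPt K ((specOver K K).hom (IsLocalRing.closedPoint K))]

/-- **Rational points with the same underlying point are equal** (translate to the origin and use
`eq_of_base_eq_origin`). [folklore] -/
theorem eq_of_left_closedPoint_eq (P Q : X.Points K)
    (h : P.left (IsLocalRing.closedPoint K) = Q.left (IsLocalRing.closedPoint K)) : P = Q := by
  have h1 : (Q⁻¹ * P).left (IsLocalRing.closedPoint K) = origin X := by
    rw [← comp_translation, Over.comp_left, Scheme.Hom.comp_apply, h, ← Scheme.Hom.comp_apply,
      ← Over.comp_left, comp_translation, inv_mul_cancel, one_left_closedPoint]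
  have h2 : Q⁻¹ * P = 1 :=
    eq_of_base_eq_origin (A := X) _ _ h1 (X.one_left_closedPoint)
  exact (inv_mul_eq_one.1 h2).symm

end Points

section RationalFibre

variable {K : Type u} [Field K]

/-- For a section `t` of `q : T → Spec K`, the composite `Spec κ(t s) → T → Spec K` is an
isomorphism (`κ(t s) = K`; cf. `fromSpecResidueField_eq_comp_section`). [folklore] -/
theorem isIso_fromSpecResidueField_comp {T : Scheme.{u}} (q : T ⟶ Spec (.of K))
    (t : Spec (.of K) ⟶ T) (ht : t ≫ q = 𝟙 _) (s : Spec (.of K)) :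
    IsIso (T.fromSpecResidueField (t s) ≫ q) := by
  obtain ⟨⟨p, φ⟩, h⟩ := (Scheme.SpecToEquivOfField K T).symm.surjective t
  have h' : Spec.map φ ≫ T.fromSpecResidueField p = t := h
  subst h'
  have hx : (Spec.map φ ≫ T.fromSpecResidueField p) s = p := by
    rw [Scheme.Hom.comp_apply, Scheme.fromSpecResidueField_apply]
  rw [hx]
  obtain ⟨ψ, hψ⟩ := Spec.map_surjective (T.fromSpecResidueField p ≫ q)
  have h1 : ψ ≫ φ = 𝟙 _ := Spec.map_injective (by
    rw [Spec.map_comp, Spec.map_id, hψ]; simpa only [Category.assoc] using ht)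
  have h1' : ∀ a, φ.hom (ψ.hom a) = a := fun a => by
    have e := congr_arg (fun f : CommRingCat.of K ⟶ CommRingCat.of K => f.hom a) h1
    simpa using e
  have h2 : φ ≫ ψ = 𝟙 _ := by
    ext b
    apply φ.hom.injective
    simp only [CommRingCat.hom_comp, CommRingCat.hom_id, RingHom.coe_comp, Function.comp_apply,
      RingHom.id_apply]
    exact h1' (φ.hom b)
  rw [← hψ]
  refine ⟨Spec.map φ, ?_, ?_⟩
  · rw [← Spec.map_comp, h2, Spec.map_id]
  · rw [← Spec.map_comp, h1, Spec.map_id]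

/-- For a rational point `t₀` of `T`, the projection `R × Spec κ(t₀) → R` is an isomorphism.
[folklore] -/
theorem isIso_fst_residuePt (R T : SchemeOver K) (t₀ : 𝟙_ (SchemeOver K) ⟶ T)
    (s : (𝟙_ (SchemeOver K)).left) :
    IsIso (CartesianMonoidalCategory.fst R (residuePt T (t₀.left s))) := by
  haveI : IsIso (CartesianMonoidalCategory.toUnit (residuePt T (t₀.left s))).left := by
    rw [Over.toUnit_left, residuePt_hom]
    exact isIso_fromSpecResidueField_comp T.hom t₀.left (by simpa using Over.w t₀) s
  haveI : IsIso ((Over.forget _).map (CartesianMonoidalCategory.toUnit (residuePt T (t₀.left s)))) := by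
    change IsIso (CartesianMonoidalCategory.toUnit (residuePt T (t₀.left s))).left
    infer_instance
  haveI : IsIso (CartesianMonoidalCategory.toUnit (residuePt T (t₀.left s))) :=
    isIso_of_reflects_iso _ (Over.forget _)
  rw [← whiskerLeft_toUnit_comp_rightUnitor_hom]
  infer_instance

end RationalFibre

end AbelianVariety

end Literature.AlgebraicGeometry.Motives
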